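import Summits.QuantumFields.BalabanUV.Beta.WardLocusRecursiveStep
import Summits.QuantumFields.BalabanUV.Beta.RecursiveWSlot

/-!
# `BalabanUV.Beta.WardLocusRecursiveStepSlot` — binder row D1, SECOND-ORDER hW (W-side), SLOT-GENERIC part B: the Ward KERNEL law `hWd j`
# of the slotted W-tables `WrecOf G S M … j` AT ANY LEVEL `j` FROM ITS THREE LEVEL-`j` TABLE LAWS, and the localisation of its residual —
# the twin of `WardLocusRecursiveStep` §1–§2 with the wall objects `(coDressKBmAt ρ Lc (KInvStep Lc j), bhKStepAt j, axEc ρ, SpureRecAt j, M1At j)`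
# replaced by SLOTS `(G j, 𝕄, E, S j, M j)` under DISPLAYED letters (β sub-cell, BINDER-OWNERS row D1 OWNER `b2b-balaban-beta-an2`, gen 29;
# INTENT «SYM-hW-SECOND-ORDER» journal [AN2-G29-ONLINE])

HONEST FRAMING (cell charter, verbatim): «discharging BetaPertH makes Bałaban's UV stability UNCONDITIONAL — a real constructive-QFT result; it is
NOT the continuum limit and NOT the Clay problem.»  HONEST DEPENDENCY: continuum YM on T⁴ ⇐ BetaPertH ∧ nine spine estimates (0/9 proved);
BetaPertH ⇐ (D1) ∧ (D4) ∧ CAP+tail; G-an2-4 gates asym, D1 and NE2/3/4.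
NOT IN PRINT; OUR BOOKKEEPING.  [folklore] kernel algebra over tree objects BY NAME (leaf-10's `KernelWardSymAssembly.divW_W2SymOfK_eq_conjV_add_residuals`,
an1's `KernelWardResidual.loc_residual`, leaf-05's `RecursiveWSlot`); EVERY resolvent socket — (DG)(LS)(LM), `Spr 𝕄`, `Spr E`, `RelInv (G j) 𝕄 E`, the
ℋ-column Ward law `hH`, the multiplier-column Ward law `hMw`, the off-lattice vanishing `hoff` of the multiplier rows, the generator's `Spr`∕`Loc`∕`[E, X y] = 0`,
the first-order law `hD` — and the three level-`j` TABLE laws (`hS₂`, `hS₂''` of `T2RecOf … j` against `S j`; `hM₂` of `M2Of mixFF j` against `M j`) with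
their bounded remainders are DISPLAYED HYPOTHESES; no statement of Bałaban's papers, no `[cite:]`, no `def`, no `def … : Prop`; instantiates NO binder of
the β-function wall.  Purpose: ONE proof serving the frozen comb template (where every socket is a landed theorem — `WardLocusRecursiveStep`) AND the
(0.4) literal «JsB12Sym» (`G := SymmetrisedStepJets.Gsym`, `𝕄 := SymShiftedSpread.bhKStepSh 3 Lc Dsh j`, `E := symEc Lc`, `S := SpureSymOf tabs`, `M := tabs.M`).
NOT hW, NOT D1, NOT `BetaPertH`, NOT continuum, NOT Clay.

* §1 **`divW_WrecOf_of_tableLaws`**: `divW (WrecOf d Lc G S M cE₂ cB T vh₂S mixFF j) y ν y′ = conjV (dM (G j) Lc (S j) (M j) ν y′) (X y) + ½ • (𝒩 + 𝒩″)`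
  with the residual DISPLAYED (an1's direct residual `𝒩` + leaf-10's swapped residual `𝒩″`) — `divW_W2SymOfK_eq_conjV_add_residuals` at
  `(K, S₂, M₂) := (G j, T2RecOf … j, M2Of mixFF j)` (`WrecOf_eq`), the tables' bounds from `RecursiveWSlot.T2RecOf_loc` ∕ `BalabanStepW2.locStencilFM_M2Of`,
  the first-order classes shrunk to one common rate.
* §2 **`loc_residual_WrecOf`**: the residual is `Loc` whenever the remainders `R y`, `R″ y` are local-stencil families and `RM y` a vertex family at one
  rate (`KernelWardResidual.loc_residual` for `𝒩`, `SecondOrderTransport.loc_dM` ×2 for `𝒩″`).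
Provenance: β sub-cell, unit beta-an2 gen 29, 2026-08-21 (v1); over the files named above BY NAME; no existing file touched.
-/

noncomputable section

open Finset
open scoped BigOperators
open Literature.MathematicalPhysics.QuantumFieldTheory
open Literature.MathematicalPhysics.QuantumFieldTheory.Balaban1983to89
open Literature.MathematicalPhysics.QuantumFieldTheory.Balaban1983to89.Beta
open B6BondElimination (unitVec)
open ExpKernelCalculus (MKer Decays BiLoc VertexFamily VertexFamily₂ comp)
open KernelWard (divV divW)
open AffineAveraging (Site box toSite)
open OneStepResolventKernel (Fib wsum LocStencil biLoc_mono)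
open OneStepKernelFamily (colH vertexOfK)
open InterLevelTransport (cwsum)
open SecondOrderResponse (colM vertexOfM dM K2OfK W2SymOfK LocStencilFM)
open BalabanCompositeJets (LocStencil₂)
open BalabanStepW2 (M2Of locStencilFM_M2Of wV4 wB2)
open Summit.QuantumFields.BalabanUV.Beta.TameKernelCalculus
open Summit.QuantumFields.BalabanUV.Beta.ChartConjugation (conjV loc_conjV)
open Summit.QuantumFields.BalabanUV.Beta.ChartConjugationRelative (RelInv)
open Summit.QuantumFields.BalabanUV.Beta.KernelWardRelative (gaugeWt)
open Summit.QuantumFields.BalabanUV.Beta.KernelWardResponse (decays_of_biLoc)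
open Summit.QuantumFields.BalabanUV.Beta.KernelWardResidual (loc_residual)
open Summit.QuantumFields.BalabanUV.Beta.KernelWardSymAssembly (divW_W2SymOfK_eq_conjV_add_residuals)
open Summit.QuantumFields.BalabanUV.Beta.SecondOrderRemainderTables (abs_le_of_locStencil₂ abs_le_of_locStencilFM)
open Summit.QuantumFields.BalabanUV.Beta.SpineRooted (T2RecOf WrecOf WrecOf_eq T2RecOf_loc)

namespace Summit.QuantumFields.BalabanUV.Beta.WardLocusRecursiveStepSlot

section Slot

variable {d Lc : ℕ} [NeZero Lc]
variable {G : ℕ → MKer (d + 1) (Fib d)} {S M : ℕ → Fin (d + 1) → (Fin (d + 1) → ℤ) → MKer (d + 1) (Fib d)}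

/-! ## §1 The kernel law of `WrecOf … j` from its level-`j` table laws -/

/-- [folklore] **THE SECOND-ORDER WARD KERNEL LAW `hWd j` OF THE SLOTTED W-TABLES FROM THEIR TABLE LAWS, ANY LEVEL `j`.**  Slots: resolvents `G`
((DG)), first-order tables `S` ((LS)), multiplier tables `M` ((LM)), binder tables `vh₂S` (`hB`), `mixFF` (`hmix`); at level `j`: a spread `𝕄` and a
spread `E` with `RelInv (G j) 𝕄 E`, the ℋ-column Ward law `hH` of `G j` (constant `cH`), the multiplier-column Ward law `hMw` of `G j`, the off-lattice
vanishing `hoff` of the multiplier rows of `G j`, a generator family `X` (spread, localised, commuting with `E`), the FIRST-ORDER law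
`hD : divV (dM (G j) Lc (S j) (M j)) y = conjV 𝕄 (X y)`.  IF the field table `T2RecOf … j` obeys the `hS₂`∕`hS₂''` laws against `S j` (remainders `R`, `R″`,
bounded) and the mixed table `M2Of mixFF j` obeys the `hM₂` law against `M j` (remainder `RM`, bounded), THEN
`divW (WrecOf … j) y ν y′ = conjV (dM (G j) Lc (S j) (M j) ν y′) (X y) + ½ • (𝒩 y ν y′ + 𝒩″ y ν y′)` with the residual DISPLAYED. -/
theorem divW_WrecOf_of_tableLaws (hLc : 1 ≤ Lc) (hG : ∀ j : ℕ, ∃ δ C : ℝ, 0 < δ ∧ 0 ≤ C ∧ Decays (G j) C δ)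
    (hS : ∀ j : ℕ, ∃ Cs δ : ℝ, 0 < δ ∧ LocStencil (S j) Cs δ) (hM : ∀ j : ℕ, ∃ CM δ : ℝ, 0 < δ ∧ VertexFamily (M j) Lc CM δ)
    (cE₂ cB : ℝ) (T : Fin 4 → Fin 4 → Fin 4 → Fin 4 → ℝ)
    {vh₂S : Fin (d + 1) → (Fin (d + 1) → ℤ) → Fin (d + 1) → (Fin (d + 1) → ℤ) → MKer (d + 1) (Fib d)}
    (hB : ∃ C δ : ℝ, 0 < δ ∧ LocStencil₂ vh₂S C δ)
    {mixFF : Fin (d + 1) → (Fin (d + 1) → ℤ) → Fin (d + 1) → (Fin (d + 1) → ℤ) → MKer (d + 1) (Fib d)}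
    (hmix : ∃ C δ : ℝ, 0 < δ ∧ LocStencilFM Lc mixFF C δ) (j : ℕ)
    {𝕄 E : MKer (d + 1) (Fib d)} (h𝕄 : Spr 𝕄) (hE : Spr E) (hR : RelInv (G j) 𝕄 E) (cH : ℝ)
    (hH : ∀ (y : Fin (d + 1) → ℤ) (κ' : Fin (d + 1)) (u : Fin (d + 1) → ℤ),
      ∑ μ, (colH (G j) Lc μ (y - unitVec μ) κ' u - colH (G j) Lc μ y κ' u) = cH * gaugeWt Lc y κ' u)
    (hMw : ∀ (y : Fin (d + 1) → ℤ) (ρ : Fin (d + 1)) (w : Fin (d + 1) → ℤ), ∑ μ, (colM (G j) Lc μ (y - unitVec μ) ρ w - colM (G j) Lc μ y ρ w) = 0)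
    (hoff : ∀ (x : Fin (d + 1) → ℤ), Literature.Probability.LatticeModels.Torus.proj Lc x ≠ 0 →
      ∀ (z : Fin (d + 1) → ℤ) (ρ μ : Fin (d + 1)), G j x z (Sum.inr ρ) (Sum.inr μ) = 0)
    {X : (Fin (d + 1) → ℤ) → MKer (d + 1) (Fib d)} (hX : ∀ y, Spr (X y)) (hXl : ∀ y, Loc (X y)) (hEX : ∀ y, comp E (X y) = comp (X y) E)
    (hD : ∀ y, divV (dM (G j) Lc (S j) (M j)) y = conjV 𝕄 (X y))
    {R R'' : (Fin (d + 1) → ℤ) → Fin (d + 1) → (Fin (d + 1) → ℤ) → MKer (d + 1) (Fib d)} {BR BR'' : ℝ}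
    (hRb : ∀ y κ u x z a b, |R y κ u x z a b| ≤ BR) (hR''b : ∀ y κ u x z a b, |R'' y κ u x z a b| ≤ BR'')
    {RM : (Fin (d + 1) → ℤ) → Fin (d + 1) → (Fin (d + 1) → ℤ) → MKer (d + 1) (Fib d)} {BR' : ℝ}
    (hRMb : ∀ y ρ w x z a b, |RM y ρ w x z a b| ≤ BR')
    (hS₂ : ∀ (y : Fin (d + 1) → ℤ) (κ' : Fin (d + 1)) (u' : Fin (d + 1) → ℤ),
      cH • ∑ v ∈ box (d + 1) Lc, divV (fun κ u => T2RecOf d Lc G S M cE₂ cB T vh₂S mixFF j κ u κ' u') ((Lc : ℤ) • y + toSite v) =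
        comp (S j κ' u') (X y) - comp (X y) (S j κ' u') + R y κ' u')
    (hS₂'' : ∀ (y : Fin (d + 1) → ℤ) (κ : Fin (d + 1)) (u : Fin (d + 1) → ℤ),
      cH • ∑ v ∈ box (d + 1) Lc, divV (T2RecOf d Lc G S M cE₂ cB T vh₂S mixFF j κ u) ((Lc : ℤ) • y + toSite v) =
        comp (S j κ u) (X y) - comp (X y) (S j κ u) + R'' y κ u)
    (hM₂ : ∀ (y : Fin (d + 1) → ℤ) (ρ' : Fin (d + 1)) (w : Fin (d + 1) → ℤ),
      cH • ∑ v ∈ box (d + 1) Lc, divV (fun κ u => M2Of d Lc mixFF j κ u ρ' w) ((Lc : ℤ) • y + toSite v) =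
        comp (M j ρ' w) (X y) - comp (X y) (M j ρ' w) + RM y ρ' w)
    (y : Fin (d + 1) → ℤ) (ν : Fin (d + 1)) (y' : Fin (d + 1) → ℤ) :
    divW (WrecOf d Lc G S M cE₂ cB T vh₂S mixFF j) y ν y' =
      conjV (dM (G j) Lc (S j) (M j) ν y') (X y)
        + (1 / 2 : ℝ) • (
          (dM (G j) Lc (R y) (RM y) ν y'
            - cH • (∑ κ, wsum (fun u => ∑' x₂, ∑ κ₂,
                comp (G j) (dM (G j) Lc (S j) (M j) ν y') u x₂ (Sum.inl κ) (Sum.inl κ₂) * gaugeWt Lc y κ₂ x₂) (S j κ)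
              + ∑ ρ', cwsum Lc (fun w => ∑' x₂, ∑ κ₂,
                comp (G j) (dM (G j) Lc (S j) (M j) ν y') ((Lc : ℤ) • w) x₂ (Sum.inr ρ') (Sum.inl κ₂) * gaugeWt Lc y κ₂ x₂) (M j ρ')))
          + (dM (G j) Lc (R'' y) (RM y) ν y' + dM (conjV (G j) (X y)) Lc (S j) (M j) ν y')) := by
  obtain ⟨δK, CK, hδK, hCK, hKd⟩ := hG j
  obtain ⟨Cs, δs, hδs, hSl⟩ := hS j
  obtain ⟨CM, δM, hδM, hMl⟩ := hM j
  -- one common rate for the resolvent and the two first-order tables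
  set m : ℝ := min δK (min δs δM) with hmdef
  have hm : 0 < m := lt_min hδK (lt_min hδs hδM)
  have hmK : m ≤ δK := min_le_left _ _
  have hmS : m ≤ δs := (min_le_right _ _).trans (min_le_left _ _)
  have hmM : m ≤ δM := (min_le_right _ _).trans (min_le_right _ _)
  have hKd' : Decays (G j) CK m := OneStepResolventKernel.decays_mono hKd hCK le_rfl hmK
  have hS' : LocStencil (S j) (|Cs|) m := fun κ u => biLoc_of_le (hSl κ u) hmS
  have hM' : VertexFamily (M j) Lc (|CM|) m := fun ρ w => biLoc_of_le (hMl ρ w) hmM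
  -- bounds of the second-order tables
  obtain ⟨C₂, δ₂, hδ₂, hT₂⟩ := T2RecOf_loc cE₂ cB T vh₂S mixFF hLc hG hS hM hB hmix j
  obtain ⟨CMx, δ₃, hδ₃, hmixl⟩ := hmix
  have hB₂ : ∀ κ u κ' u' x z a b, |T2RecOf d Lc G S M cE₂ cB T vh₂S mixFF j κ u κ' u' x z a b| ≤ C₂ :=
    fun κ u κ' u' x z a b => abs_le_of_locStencil₂ hT₂ hδ₂.le κ u κ' u' x z a b
  have hB₂' : ∀ κ u ρ' w x z a b, |M2Of d Lc mixFF j κ u ρ' w x z a b| ≤ |BalabanStepW2.wM2 d Lc j| * CMx :=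
    fun κ u ρ' w x z a b => abs_le_of_locStencilFM (locStencilFM_M2Of hmixl j) hδ₃.le κ u ρ' w x z a b
  rw [WrecOf_eq]
  exact divW_W2SymOfK_eq_conjV_add_residuals hKd' hCK hm h𝕄 hE hR hS' hM' hB₂ hB₂' cH hH hMw hoff hX hXl hEX hD hRb hR''b hRMb
    hS₂ hS₂'' hM₂ y ν y'

/-! ## §2 The residual is localised -/

/-- [folklore] **THE RESIDUAL OF `hWd j` IS LOCALISED** (the `h𝒩` input of part A at level `j+1`, the `hNr` socket of the hW END): for remainders `R y`,
`R″ y` local-stencil families and `RM y` a vertex family at one rate `mR > 0` (any constants), a decaying `G j`, localised `S j`∕`M j` and a localised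
generator `X y`, the displayed residual `½ • (𝒩 + 𝒩″)` of §1 is `Loc` at every `(y, ν, y′)` — an1's `KernelWardResidual.loc_residual` for `𝒩` (tables
shrunk to one common rate), `SecondOrderTransport.loc_dM` for the two vertices of `𝒩″` (the rotated one over the spread kernel `conjV (G j) (X y)`). -/
theorem loc_residual_WrecOf (hG : ∀ j : ℕ, ∃ δ C : ℝ, 0 < δ ∧ 0 ≤ C ∧ Decays (G j) C δ)
    (hS : ∀ j : ℕ, ∃ Cs δ : ℝ, 0 < δ ∧ LocStencil (S j) Cs δ) (hM : ∀ j : ℕ, ∃ CM δ : ℝ, 0 < δ ∧ VertexFamily (M j) Lc CM δ) (j : ℕ) (cH : ℝ)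
    {X : (Fin (d + 1) → ℤ) → MKer (d + 1) (Fib d)} (hXl : ∀ y, Loc (X y))
    {R R'' : (Fin (d + 1) → ℤ) → Fin (d + 1) → (Fin (d + 1) → ℤ) → MKer (d + 1) (Fib d)}
    {RM : (Fin (d + 1) → ℤ) → Fin (d + 1) → (Fin (d + 1) → ℤ) → MKer (d + 1) (Fib d)} {CR CR'' CRM mR : ℝ} (hmR : 0 < mR)
    (hRl : ∀ y, LocStencil (R y) CR mR) (hR''l : ∀ y, LocStencil (R'' y) CR'' mR) (hRMl : ∀ y, VertexFamily (RM y) Lc CRM mR)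
    (y : Fin (d + 1) → ℤ) (ν : Fin (d + 1)) (y' : Fin (d + 1) → ℤ) :
    Loc ((1 / 2 : ℝ) • (
          (dM (G j) Lc (R y) (RM y) ν y'
            - cH • (∑ κ, wsum (fun u => ∑' x₂, ∑ κ₂,
                comp (G j) (dM (G j) Lc (S j) (M j) ν y') u x₂ (Sum.inl κ) (Sum.inl κ₂) * gaugeWt Lc y κ₂ x₂) (S j κ)
              + ∑ ρ', cwsum Lc (fun w => ∑' x₂, ∑ κ₂,
                comp (G j) (dM (G j) Lc (S j) (M j) ν y') ((Lc : ℤ) • w) x₂ (Sum.inr ρ') (Sum.inl κ₂) * gaugeWt Lc y κ₂ x₂) (M j ρ')))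
          + (dM (G j) Lc (R'' y) (RM y) ν y' + dM (conjV (G j) (X y)) Lc (S j) (M j) ν y'))) := by
  obtain ⟨δK, CK, hδK, hCK, hKd⟩ := hG j
  obtain ⟨Cs, δs, hδs, hSl⟩ := hS j
  obtain ⟨CM, δM, hδM, hMl⟩ := hM j
  -- one common rate for `G j`, `S j`, `M j`, `R`, `R''`, `RM`
  set m : ℝ := min mR (min δK (min δs δM)) with hmdef
  have hm : 0 < m := lt_min hmR (lt_min hδK (lt_min hδs hδM))
  have hmR' : m ≤ mR := min_le_left _ _
  have hmK : m ≤ δK := (min_le_right _ _).trans (min_le_left _ _)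
  have hmS : m ≤ δs := (min_le_right _ _).trans ((min_le_right _ _).trans (min_le_left _ _))
  have hmM : m ≤ δM := (min_le_right _ _).trans ((min_le_right _ _).trans (min_le_right _ _))
  have hKd' : Decays (G j) CK m := OneStepResolventKernel.decays_mono hKd hCK le_rfl hmK
  have hS' : LocStencil (S j) (|Cs|) m := fun κ u => biLoc_of_le (hSl κ u) hmS
  have hM' : VertexFamily (M j) Lc (|CM|) m := fun ρ w => biLoc_of_le (hMl ρ w) hmM
  have hRl' : ∀ y, LocStencil (R y) (|CR|) m := fun y κ u => biLoc_of_le (hRl y κ u) hmR'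
  have hR''l' : ∀ y, LocStencil (R'' y) (|CR''|) m := fun y κ u => biLoc_of_le (hR''l y κ u) hmR'
  have hRMl' : ∀ y, VertexFamily (RM y) Lc (|CRM|) m := fun y ρ' w => biLoc_of_le (hRMl y ρ' w) hmR'
  -- 𝒩 (an1's residual)
  have h𝒩 := loc_residual (N := Lc) hKd' hCK hm hS' hM' hRl' hRMl' cH y ν y'
  -- 𝒩″: two differentiated vertices
  have h1 : Loc (dM (G j) Lc (R'' y) (RM y) ν y') := SecondOrderTransport.loc_dM hKd' hCK (hR''l' y) (hRMl' y) hm le_rfl ν y'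
  have hKs : Spr (G j) := ⟨CK, δK, hδK, hKd⟩
  obtain ⟨p, q, CV, δV, hδV, hV⟩ := loc_conjV hKs (hXl y)
  have hVd := decays_of_biLoc hV hδV.le
  have hm' : 0 < min m δV := lt_min hm hδV
  have h2 : Loc (dM (conjV (G j) (X y)) Lc (S j) (M j) ν y') :=
    SecondOrderTransport.loc_dM hVd (mul_nonneg (hV.nonneg (Sum.inl 0)) (Real.exp_pos _).le)
      (fun κ u => biLoc_of_le (hSl κ u) ((min_le_left _ _).trans hmS)) (fun ρ w => biLoc_of_le (hMl ρ w) ((min_le_left _ _).trans hmM))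
      hm' (min_le_right _ _) ν y'
  exact ((h𝒩.add (h1.add h2)).smul (1 / 2 : ℝ))

end Slot

end Summit.QuantumFields.BalabanUV.Beta.WardLocusRecursiveStepSlot

end
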